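import Literature.MathematicalPhysics.KineticTheory.LambertianRedrawNondegenerate
import Literature.MathematicalPhysics.KineticTheory.HardSphereEuler
import HarnessLib

/-!
# The restricted strong-Markov (fresh-tail) identity of the Lambertian hard-sphere flow
# (`LambertianContactSwap.LambertianEuler`, stmt-AtomisticToContinuum-11854, line `Sketch`;
# stub `stub_markovLambda`)

For the Lambertian hard-sphere flow `Λ_t(z; ξs) = lambertFlow G ε ξs z t` of
`Literature.MathematicalPhysics.KineticTheory.LambertianHardSphereFlow` driven by the i.i.d.
Gaussian sequence `ξs ∼ γ^ℕ = lambertNoise`: at a deterministic time `s`, restricted to a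
measurable event `A ⊆ {∃ k, s < t_k}` of the PAST (membership only depends on the redraws consumed
up to time `s`, `ξs 0, …, ξs (K_s - 1)`, `K_s = lambertCount`), the unconsumed noise `ξs (· + K_s)`
is a fresh `γ^ℕ` sequence independent of `Λ_s`:
`∫ 1_A H(Λ_s, ξs (· + K_s)) dγ^ℕ = ∫ 1_A (∫ H(Λ_s, ηs) dγ^ℕ(ηs)) dγ^ℕ`
(`lintegral_indicator_freshTail_of_local`); the registered stub `stub_markovLambda` is its
instance for the checkpoint events `{∃ k, s < t_k} ∩ {(Λ_{r_i})_i ∈ Q}`, `r_i ≤ s`, on `𝕋³`. No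
almost-sure non-accumulation hypothesis: the event itself excludes the Zeno set.

Proof: (1) locality — the states `z_k`, `k ≤ n`, the instants `t_k`, `k ≤ n + 1`, and hence the
count and the flow at every time `u < t_{n+1}` only depend on `ξs 0, …, ξs (n-1)`
(`lambertStateAfter_congr`, `lambertInstant_congr`, `lambertFlow_congr_of_lt`); (2) independence —
under `γ^ℕ = Measure.infinitePi _` the truncation `(ξs 0, …, ξs (n-1), 0, …)` and the tail
`ξs (· + n)` are independent, the tail being `γ^ℕ` (`indepFun_truncAt_tailFrom`, coordinates over
the disjoint index sets `Iio n`, `Ici n`), whence a Tonelli identity; (3) both combine on an event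
local below `n` (`lintegral_indicator_local_tail`), and (4) the pieces `A ∩ {K_s = n}` are summed
(`tsum_ite_eq'`, `lintegral_tsum`). All [folklore] (strong Markov property of i.i.d. redraws read
at a stopping index); nothing is redefined, no named fact is introduced.
-/

noncomputable section

open scoped BigOperators Topology ENNReal InnerProductSpace
open MeasureTheory ProbabilityTheory Filter Set
open Literature.MathematicalPhysics.KineticTheory
open Literature.Analysis.FluidPDE Literature.Analysis.FluidPDE.Alexander

namespace Summit.AtomisticToContinuum.HydrodynamicLimit.Theorems.LambertianContactSwapLambertianEulerMarkov

/-! ## Locality of the Lambertian recursion in the consumed noise -/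

section Locality

variable {d : Type*} [Fintype d] {X : Type*} {N : ℕ} {G : Geometry d X} {ε : ℝ}
  {ξs ξs' : ℕ → EuclideanSpace ℝ d} {z : Config N d X}

/-- The `k`-th post-collisional state only depends on the first `k` redraws: two noise sequences
agreeing below `n` give the same states `z_k`, `k ≤ n`. [folklore] -/
theorem lambertStateAfter_congr {n k : ℕ} (h : ∀ i < n, ξs i = ξs' i) (hk : k ≤ n) :
    lambertStateAfter G ε ξs z k = lambertStateAfter G ε ξs' z k := by
  induction k with
  | zero => rw [lambertStateAfter_zero, lambertStateAfter_zero]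
  | succ k ih =>
    rw [lambertStateAfter_succ, lambertStateAfter_succ, ih (Nat.le_of_succ_le hk),
      h k (Nat.lt_of_succ_le hk)]

/-- The instants `t_k = ∑_{m<k} τ(z_m)`, `k ≤ n + 1`, only depend on the first `n` redraws.
[folklore] -/
theorem lambertInstant_congr {n k : ℕ} (h : ∀ i < n, ξs i = ξs' i) (hk : k ≤ n + 1) :
    lambertInstant G ε ξs z k = lambertInstant G ε ξs' z k := by
  induction k with
  | zero => rw [lambertInstant_zero, lambertInstant_zero]
  | succ k ih =>
    rw [lambertInstant_succ, lambertInstant_succ, ih (Nat.le_of_succ_le hk),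
      lambertStateAfter_congr h (Nat.le_of_succ_le_succ hk)]

/-- If some instant exceeds `u` then `u` lies in a collision segment `t_k ≤ u < t_{k+1}`
(`t_0 = 0`, first instant beyond `u`). [folklore] -/
theorem exists_lambertSegment {u : ℝ} (hex : ∃ k, ENNReal.ofReal u < lambertInstant G ε ξs z k) :
    ∃ k, lambertInstant G ε ξs z k ≤ ENNReal.ofReal u ∧
      ENNReal.ofReal u < lambertInstant G ε ξs z (k + 1) := by
  classical
  have hm0 : Nat.find hex ≠ 0 := fun h0 => by simpa [h0] using Nat.find_spec hex
  obtain ⟨k, hk⟩ := Nat.exists_eq_add_one_of_ne_zero hm0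
  exact ⟨k, not_lt.1 (Nat.find_min hex (m := k) (by omega)), hk ▸ Nat.find_spec hex⟩

/-- On `{K_u = n}`, if some instant exceeds `u`, the segment of `u` is the `n`-th one:
`t_n ≤ u < t_{n+1}` (off the Zeno set the count is not the junk value). [folklore] -/
theorem lambertSegment_of_count_eq {u : ℝ} {n : ℕ}
    (hex : ∃ k, ENNReal.ofReal u < lambertInstant G ε ξs z k) (hK : lambertCount G ε ξs z u = n) :
    lambertInstant G ε ξs z n ≤ ENNReal.ofReal u ∧
      ENNReal.ofReal u < lambertInstant G ε ξs z (n + 1) := by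
  obtain ⟨k, h1, h2⟩ := exists_lambertSegment hex
  obtain rfl : k = n := (lambertCount_eq_of_segment h1 h2).symm.trans hK
  exact ⟨h1, h2⟩

/-- **Locality of the count and of the flow before `t_{n+1}`**: two noise sequences agreeing below
`n` have the same number of collisions and the same state at every time `u < t_{n+1}`. [folklore] -/
theorem lambertFlow_congr_of_lt {n : ℕ} {u : ℝ} (h : ∀ i < n, ξs i = ξs' i)
    (hu : ENNReal.ofReal u < lambertInstant G ε ξs z (n + 1)) :
    lambertCount G ε ξs' z u = lambertCount G ε ξs z u ∧
      lambertFlow G ε ξs' z u = lambertFlow G ε ξs z u ∧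
      ∃ k, ENNReal.ofReal u < lambertInstant G ε ξs' z k := by
  obtain ⟨j, h1, h2⟩ := exists_lambertSegment ⟨n + 1, hu⟩
  have hj : j ≤ n := by
    by_contra hjn
    exact (not_le.2 hu)
      ((monotone_lambertInstant ξs z (Nat.succ_le_of_lt (not_le.1 hjn))).trans h1)
  have h1' : lambertInstant G ε ξs' z j ≤ ENNReal.ofReal u := by
    rwa [← lambertInstant_congr h (Nat.le_succ_of_le hj)]
  have h2' : ENNReal.ofReal u < lambertInstant G ε ξs' z (j + 1) := by
    rwa [← lambertInstant_congr h (Nat.succ_le_succ hj)]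
  refine ⟨?_, ?_, ⟨j + 1, h2'⟩⟩
  · rw [lambertCount_eq_of_segment h1 h2, lambertCount_eq_of_segment h1' h2']
  · rw [lambertFlow_eq_of_segment h1 h2, lambertFlow_eq_of_segment h1' h2',
      lambertInstant_congr h (Nat.le_succ_of_le hj), lambertStateAfter_congr h hj]

/-- **The checkpoint event is local**: membership of `ξs` in `{∃ k, s < t_k} ∩ {(Λ_{r_i})_i ∈ Q}`,
`r_i ≤ s`, only depends on the first `K_s(ξs)` redraws. [folklore] -/
theorem checkpointEvent_local {s : ℝ} {m : ℕ} {r : Fin m → ℝ} (hr : ∀ i, r i ≤ s)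
    {Q : Set (Fin m → Config N d X)}
    (hex : ∃ k, ENNReal.ofReal s < lambertInstant G ε ξs z k)
    (hQ : (fun i => lambertFlow G ε ξs z (r i)) ∈ Q)
    (h : ∀ i < lambertCount G ε ξs z s, ξs i = ξs' i) :
    (∃ k, ENNReal.ofReal s < lambertInstant G ε ξs' z k) ∧
      (fun i => lambertFlow G ε ξs' z (r i)) ∈ Q := by
  obtain ⟨-, h2⟩ := lambertSegment_of_count_eq hex rfl
  refine ⟨(lambertFlow_congr_of_lt h h2).2.2, ?_⟩
  have hcp : (fun i => lambertFlow G ε ξs' z (r i)) = fun i => lambertFlow G ε ξs z (r i) :=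
    funext fun i =>
      (lambertFlow_congr_of_lt h ((ENNReal.ofReal_le_ofReal (hr i)).trans_lt h2)).2.1
  rwa [hcp]

end Locality

/-! ## The noise: truncation below `n` and tail from `n` are independent -/

section Noise

variable (d : Type*)

/-- The tail map `ξs ↦ (m ↦ ξs (m + n))` is measurable. [folklore] -/
theorem measurable_tailFrom (n : ℕ) :
    Measurable fun (ξs : ℕ → EuclideanSpace ℝ d) (m : ℕ) => ξs (m + n) :=
  measurable_pi_lambda _ fun m => measurable_pi_apply (m + n)

/-- The truncation `ξs ↦ (ξs 0, …, ξs (n-1), 0, 0, …)` is measurable. [folklore] -/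
theorem measurable_truncAt (n : ℕ) :
    Measurable fun (ξs : ℕ → EuclideanSpace ℝ d) (i : ℕ) => if i < n then ξs i else 0 := by
  refine measurable_pi_lambda _ fun i => ?_
  by_cases hi : i < n
  · simpa only [if_pos hi] using measurable_pi_apply i
  · simpa only [if_neg hi] using measurable_const

/-- Reading a measurable noise sequence from a measurable random index on is again a measurable
sequence: `a ↦ (m ↦ ξs a (m + K a))`. [folklore] -/
theorem measurable_shiftBy {α : Type*} [MeasurableSpace α] {K : α → ℕ} (hK : Measurable K)
    {ξs : α → ℕ → EuclideanSpace ℝ d} (hξs : Measurable ξs) :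
    Measurable fun a => fun m => ξs a (m + K a) := by
  refine measurable_pi_lambda _ fun m => ?_
  have h : (fun a => ξs a (m + K a)) =
      (fun p : (ℕ → EuclideanSpace ℝ d) × ℕ => p.1 (m + p.2)) ∘ fun a => (ξs a, K a) := rfl
  rw [h]
  exact (measurable_from_prod_countable_left fun k => measurable_pi_apply (m + k)).comp
    (hξs.prodMk hK)

variable [Fintype d]

/-- **Shift invariance of the Lambertian noise by `n`**: dropping the first `n` Gaussian vectors
of an i.i.d. sequence leaves an i.i.d. sequence with the same law. [folklore] -/
theorem lambertNoise_map_tailFrom (n : ℕ) :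
    (lambertNoise d).map (fun (ξs : ℕ → EuclideanSpace ℝ d) (m : ℕ) => ξs (m + n)) =
      lambertNoise d :=
  Measure.map_infinitePi_infinitePi_of_inj (P := fun _ : ℕ => stdGaussian (EuclideanSpace ℝ d))
    (f := fun m : ℕ => m + n) (add_left_injective n)

/-- **Truncation below `n` and tail from `n` of the Lambertian noise are independent**
(coordinates of a product measure over the disjoint index sets `Iio n` and `Ici n`). [folklore] -/
theorem indepFun_truncAt_tailFrom (n : ℕ) :
    IndepFun (fun (ξs : ℕ → EuclideanSpace ℝ d) (i : ℕ) => if i < n then ξs i else 0)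
      (fun (ξs : ℕ → EuclideanSpace ℝ d) (m : ℕ) => ξs (m + n)) (lambertNoise d) := by
  have hi : iIndepFun (fun (i : ℕ) (ξs : ℕ → EuclideanSpace ℝ d) => ξs i) (lambertNoise d) :=
    iIndepFun_infinitePi (P := fun _ : ℕ => stdGaussian (EuclideanSpace ℝ d))
      (X := fun _ x => x) fun _ => measurable_id
  rw [iIndepFun_iff_iIndep] at hi
  have h := indep_iSup_of_disjoint (fun i => (measurable_pi_apply i).comap_le) hi
    (Set.Iio_disjoint_Ici (le_refl n))
  rw [IndepFun_iff_Indep]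
  refine indep_of_indep_of_le_right (indep_of_indep_of_le_left h ?_) ?_
  · refine (le_of_eq (MeasurableSpace.comap_process_pi
      (fun (i : ℕ) (ξs : ℕ → EuclideanSpace ℝ d) => if i < n then ξs i else 0))).trans
      (iSup_le fun i => ?_)
    by_cases hin : i < n
    · simp only [if_pos hin]
      exact le_iSup₂_of_le (f := fun (j : ℕ) (_ : j ∈ Set.Iio n) =>
        MeasurableSpace.comap (fun ξs : ℕ → EuclideanSpace ℝ d => ξs j) inferInstance)
        i (Set.mem_Iio.2 hin) le_rfl
    · simp only [if_neg hin, MeasurableSpace.comap_const, bot_le]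
  · refine (le_of_eq (MeasurableSpace.comap_process_pi
      (fun (m : ℕ) (ξs : ℕ → EuclideanSpace ℝ d) => ξs (m + n)))).trans (iSup_le fun m => ?_)
    exact le_iSup₂_of_le (f := fun (j : ℕ) (_ : j ∈ Set.Ici n) =>
      MeasurableSpace.comap (fun ξs : ℕ → EuclideanSpace ℝ d => ξs j) inferInstance)
      (m + n) (Set.mem_Ici.2 (Nat.le_add_left n m)) le_rfl

/-- **Truncation/tail decomposition of the Lambertian noise**: `ξs ↦ (truncation, tail)` pushes
`γ^ℕ` forward to `(law of the truncation) ⊗ γ^ℕ`. [folklore] -/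
theorem lambertNoise_map_truncAt_tailFrom (n : ℕ) :
    (lambertNoise d).map (fun ξs : ℕ → EuclideanSpace ℝ d =>
        ((fun i : ℕ => if i < n then ξs i else 0), fun m : ℕ => ξs (m + n))) =
      ((lambertNoise d).map fun (ξs : ℕ → EuclideanSpace ℝ d) (i : ℕ) =>
        if i < n then ξs i else 0).prod (lambertNoise d) := by
  rw [(indepFun_truncAt_tailFrom d n).map_prod_eq_prod_map_map (measurable_truncAt d n).aemeasurable
    (measurable_tailFrom d n).aemeasurable, lambertNoise_map_tailFrom d n]

/-- **Tonelli over the tail from `n`**: a `lintegral` against `γ^ℕ` of a measurable function of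
(truncation below `n`, tail from `n`) is the iterated `lintegral` with a fresh tail. [folklore] -/
theorem lintegral_truncAt_tailFrom (n : ℕ)
    {F : (ℕ → EuclideanSpace ℝ d) → (ℕ → EuclideanSpace ℝ d) → ℝ≥0∞}
    (hF : Measurable fun p : (ℕ → EuclideanSpace ℝ d) × (ℕ → EuclideanSpace ℝ d) => F p.1 p.2) :
    ∫⁻ ξs, F (fun i => if i < n then ξs i else 0) (fun m => ξs (m + n)) ∂(lambertNoise d) =
      ∫⁻ ξs, ∫⁻ ηs, F (fun i => if i < n then ξs i else 0) ηs ∂(lambertNoise d)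
        ∂(lambertNoise d) :=
  calc ∫⁻ ξs, F (fun i => if i < n then ξs i else 0) (fun m => ξs (m + n)) ∂(lambertNoise d)
      = ∫⁻ p, F p.1 p.2 ∂((lambertNoise d).map fun ξs =>
          ((fun i : ℕ => if i < n then ξs i else 0), fun m : ℕ => ξs (m + n))) :=
        (lintegral_map hF ((measurable_truncAt d n).prodMk (measurable_tailFrom d n))).symm
    _ = ∫⁻ p, F p.1 p.2 ∂(((lambertNoise d).map fun ξs (i : ℕ) =>
          if i < n then ξs i else 0).prod (lambertNoise d)) := by
        rw [lambertNoise_map_truncAt_tailFrom]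
    _ = ∫⁻ x, ∫⁻ ηs, F x ηs ∂(lambertNoise d)
          ∂((lambertNoise d).map fun ξs (i : ℕ) => if i < n then ξs i else 0) :=
        lintegral_prod _ hF.aemeasurable
    _ = _ := lintegral_map (hF.lintegral_prod_right' (ν := lambertNoise d)) (measurable_truncAt d n)

/-- **Fresh tail on a local event, deterministic shift.** If a measurable event `A` and a
measurable state `Λ` are *local below `n`* (a sequence agreeing below `n` with a member of `A` is
in `A`, with the same state), `∫ 1_A H(Λ, ξs (· + n)) dγ^ℕ = ∫ 1_A (∫ H(Λ, ηs) dγ^ℕ(ηs)) dγ^ℕ`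
for measurable `H ≥ 0`. [folklore] -/
theorem lintegral_indicator_local_tail {C : Type*} [MeasurableSpace C] (n : ℕ)
    {A : Set (ℕ → EuclideanSpace ℝ d)} (hA : MeasurableSet A)
    {Λ : (ℕ → EuclideanSpace ℝ d) → C} (hΛ : Measurable Λ)
    (hloc : ∀ ζ ζ' : ℕ → EuclideanSpace ℝ d, (∀ i < n, ζ i = ζ' i) → ζ ∈ A → ζ' ∈ A ∧ Λ ζ' = Λ ζ)
    {H : C × (ℕ → EuclideanSpace ℝ d) → ℝ≥0∞} (hH : Measurable H) :
    ∫⁻ ζ, A.indicator (fun ζ => H (Λ ζ, fun m => ζ (m + n))) ζ ∂(lambertNoise d) =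
      ∫⁻ ζ, A.indicator (fun ζ => ∫⁻ ηs, H (Λ ζ, ηs) ∂(lambertNoise d)) ζ ∂(lambertNoise d) := by
  classical
  have hFm : Measurable fun p : (ℕ → EuclideanSpace ℝ d) × (ℕ → EuclideanSpace ℝ d) =>
      if p.1 ∈ A then H (Λ p.1, p.2) else 0 :=
    Measurable.ite (measurable_fst hA) (hH.comp ((hΛ.comp measurable_fst).prodMk measurable_snd))
      measurable_const
  have hagree : ∀ ζ : ℕ → EuclideanSpace ℝ d, ∀ i < n,
      (fun j => if j < n then ζ j else 0) i = ζ i := fun ζ i hi => if_pos hi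
  have hmem : ∀ ζ : ℕ → EuclideanSpace ℝ d, (fun j => if j < n then ζ j else 0) ∈ A → ζ ∈ A :=
    fun ζ hT => (hloc (fun j => if j < n then ζ j else 0) ζ (hagree ζ) hT).1
  have h1 : ∀ ζ : ℕ → EuclideanSpace ℝ d, A.indicator (fun ζ => H (Λ ζ, fun m => ζ (m + n))) ζ =
      if (fun j => if j < n then ζ j else 0) ∈ A then
        H (Λ (fun j => if j < n then ζ j else 0), fun m => ζ (m + n)) else 0 := by
    intro ζ
    by_cases hζ : ζ ∈ A
    · obtain ⟨hT, hΛT⟩ :=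
        hloc ζ (fun j => if j < n then ζ j else 0) (fun i hi => (hagree ζ i hi).symm) hζ
      rw [Set.indicator_of_mem hζ, if_pos hT, hΛT]
    · rw [Set.indicator_of_notMem hζ, if_neg fun hT => hζ (hmem ζ hT)]
  have h2 : ∀ ζ : ℕ → EuclideanSpace ℝ d,
      ∫⁻ ηs, (if (fun j => if j < n then ζ j else 0) ∈ A then
        H (Λ (fun j => if j < n then ζ j else 0), ηs) else 0) ∂(lambertNoise d) =
      A.indicator (fun ζ => ∫⁻ ηs, H (Λ ζ, ηs) ∂(lambertNoise d)) ζ := by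
    intro ζ
    by_cases hζ : ζ ∈ A
    · obtain ⟨hT, hΛT⟩ :=
        hloc ζ (fun j => if j < n then ζ j else 0) (fun i hi => (hagree ζ i hi).symm) hζ
      simp only [if_pos hT, hΛT, Set.indicator_of_mem hζ]
    · simp only [if_neg fun hT => hζ (hmem ζ hT), lintegral_zero, Set.indicator_of_notMem hζ]
  exact ((lintegral_congr h1).trans (lintegral_truncAt_tailFrom d n
    (F := fun x y => if x ∈ A then H (Λ x, y) else 0) hFm)).trans (lintegral_congr h2)

end Noise

/-! ## The fresh-tail identity restricted to a local event, and the registered stub on `𝕋³` -/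

section Markov

variable {d : Type*} [Fintype d] {X : Type*} {N : ℕ} [MeasurableSpace X] [TopologicalSpace X]
  {G : Geometry d X} {ε : ℝ}

omit [Fintype d] [TopologicalSpace X] in
/-- A measurable map of (datum, noise) is measurable in the noise at a fixed datum. [folklore] -/
theorem measurable_fixDatum {β : Type*} [MeasurableSpace β]
    {F : Config N d X × (ℕ → EuclideanSpace ℝ d) → β} (hF : Measurable F) (z : Config N d X) :
    Measurable fun ξs : ℕ → EuclideanSpace ℝ d => F (z, ξs) := by
  have h : (fun ξs : ℕ → EuclideanSpace ℝ d => F (z, ξs)) = F ∘ fun ξs => (z, ξs) := rfl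
  rw [h]
  exact hF.comp (measurable_const.prodMk measurable_id)

/-- Cutting a `lintegral` by the level sets of a measurable index:
`∫ f = ∑_n ∫ 1{K = n} f` (`tsum_ite_eq'`, `lintegral_tsum`). [folklore] -/
theorem lintegral_eq_tsum_pieces {α : Type*} [MeasurableSpace α] {μ : Measure α} {K : α → ℕ}
    (hK : Measurable K) {f : α → ℝ≥0∞} (hf : Measurable f) :
    ∫⁻ a, f a ∂μ = ∑' n : ℕ, ∫⁻ a, (if K a = n then f a else 0) ∂μ :=
  (lintegral_congr fun a => (tsum_ite_eq' (K a) fun _ => f a).symm).trans (lintegral_tsum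
    fun n => (Measurable.ite (hK (measurableSet_singleton n)) hf measurable_const).aemeasurable)

/-- The checkpoint event `{∃ k, s < t_k} ∩ {(Λ_{r_i})_i ∈ Q}` is measurable in the noise.
[folklore] -/
theorem measurableSet_checkpointEvent (hG : G.IsHardSphereRegular ε) (hGm : G.IsMeasurable)
    (z : Config N d X) (s : ℝ) {m : ℕ} (r : Fin m → ℝ) {Q : Set (Fin m → Config N d X)}
    (hQ : MeasurableSet Q) :
    MeasurableSet {ξs : ℕ → EuclideanSpace ℝ d |
      (∃ k, ENNReal.ofReal s < lambertInstant G ε ξs z k) ∧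
      (fun i => lambertFlow G ε ξs z (r i)) ∈ Q} := by
  have hI : ∀ k, Measurable fun ξs : ℕ → EuclideanSpace ℝ d => lambertInstant G ε ξs z k :=
    fun k => measurable_fixDatum (measurable_lambertInstant hG hGm k) z
  exact measurableSet_setOf.2 ((Measurable.exists fun k => measurableSet_setOf.1
    (measurableSet_lt measurable_const (hI k))).and (measurableSet_setOf.1
      ((measurable_pi_lambda _ fun i => measurable_lambertFlow_right hG hGm z (r i)) hQ)))

/-- **Fresh tail of the Lambertian noise at time `s`, restricted to a local event (strong Markov
property of the i.i.d. redraws, Tonelli form).** For a regular measurable geometry, a datum `z`, a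
time `s`, a measurable event `A` of noise sequences inside `{∃ k, s < t_k}` and *local up to time
`s`* (a sequence agreeing with `ζ ∈ A` below `K_s(ζ)` is in `A`), and a measurable `H ≥ 0`:
`∫ 1_A H(Λ_s(z;ξs), ξs (· + K_s)) dγ^ℕ(ξs) = ∫ 1_A (∫ H(Λ_s(z;ξs), ηs) dγ^ℕ(ηs)) dγ^ℕ(ξs)`. Sum
over the pieces `A ∩ {K_s = n}` (local below `n`) of `lintegral_indicator_local_tail`. [folklore] -/
theorem lintegral_indicator_freshTail_of_local (hG : G.IsHardSphereRegular ε)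
    (hGm : G.IsMeasurable) (z : Config N d X) (s : ℝ) {A : Set (ℕ → EuclideanSpace ℝ d)}
    (hA : MeasurableSet A) (hA1 : ∀ ζ ∈ A, ∃ k, ENNReal.ofReal s < lambertInstant G ε ζ z k)
    (hA2 : ∀ ζ ζ' : ℕ → EuclideanSpace ℝ d, ζ ∈ A →
      (∀ i < lambertCount G ε ζ z s, ζ i = ζ' i) → ζ' ∈ A)
    {H : Config N d X × (ℕ → EuclideanSpace ℝ d) → ℝ≥0∞} (hH : Measurable H) :
    ∫⁻ ξs, A.indicator (fun ξs => H (lambertFlow G ε ξs z s,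
        fun n => ξs (n + lambertCount G ε ξs z s))) ξs ∂(lambertNoise d) =
      ∫⁻ ξs, A.indicator (fun ξs => ∫⁻ ηs, H (lambertFlow G ε ξs z s, ηs) ∂(lambertNoise d)) ξs
        ∂(lambertNoise d) := by
  classical
  have hK : Measurable fun ξs : ℕ → EuclideanSpace ℝ d => lambertCount G ε ξs z s :=
    measurable_fixDatum (measurable_lambertCount hG hGm s) z
  have hΛ : Measurable fun ξs : ℕ → EuclideanSpace ℝ d => lambertFlow G ε ξs z s :=
    measurable_lambertFlow_right hG hGm z s
  have hf : Measurable fun ξs : ℕ → EuclideanSpace ℝ d =>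
      H (lambertFlow G ε ξs z s, fun n => ξs (n + lambertCount G ε ξs z s)) :=
    hH.comp (hΛ.prodMk (measurable_shiftBy d hK measurable_id))
  have hg : Measurable fun ξs : ℕ → EuclideanSpace ℝ d =>
      ∫⁻ ηs, H (lambertFlow G ε ξs z s, ηs) ∂(lambertNoise d) :=
    hH.lintegral_prod_right'.comp hΛ
  have hsplit : ∀ (φ : ℕ → (ℕ → EuclideanSpace ℝ d) → ℝ≥0∞) (n : ℕ) (ξs : ℕ → EuclideanSpace ℝ d),
      (if lambertCount G ε ξs z s = n then
        A.indicator (fun ζ => φ (lambertCount G ε ζ z s) ζ) ξs else 0) =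
      {ζ | lambertCount G ε ζ z s = n ∧ ζ ∈ A}.indicator (φ n) ξs := by
    intro φ n ξs
    simp only [Set.indicator_apply, Set.mem_setOf_eq]
    by_cases hn : lambertCount G ε ξs z s = n <;> by_cases hξ : ξs ∈ A <;> simp [hn, hξ]
  -- the identity on the piece `A ∩ {K_s = n}`, on which the shift is `n`
  have hpiece : ∀ n : ℕ,
      ∫⁻ ξs, (if lambertCount G ε ξs z s = n then A.indicator (fun ξs =>
          H (lambertFlow G ε ξs z s, fun m => ξs (m + lambertCount G ε ξs z s))) ξs else 0)
          ∂(lambertNoise d) =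
        ∫⁻ ξs, (if lambertCount G ε ξs z s = n then A.indicator (fun ξs =>
          ∫⁻ ηs, H (lambertFlow G ε ξs z s, ηs) ∂(lambertNoise d)) ξs else 0)
          ∂(lambertNoise d) := by
    intro n
    refine (lintegral_congr (hsplit (fun k ζ => H (lambertFlow G ε ζ z s, fun m => ζ (m + k)))
      n)).trans (Eq.trans ?_ (lintegral_congr (hsplit (fun _ ζ =>
        ∫⁻ ηs, H (lambertFlow G ε ζ z s, ηs) ∂(lambertNoise d)) n)).symm)
    refine lintegral_indicator_local_tail d n (A := {ζ | lambertCount G ε ζ z s = n ∧ ζ ∈ A})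
      ((hK (measurableSet_singleton n)).inter hA) hΛ ?_ hH
    rintro ζ ζ' h ⟨hKζ, hζ⟩
    obtain ⟨-, h2⟩ := lambertSegment_of_count_eq (hA1 ζ hζ) hKζ
    obtain ⟨hK', hflow, -⟩ := lambertFlow_congr_of_lt h h2
    exact ⟨⟨hK'.trans hKζ, hA2 ζ ζ' hζ (by rw [hKζ]; exact h)⟩, hflow⟩
  exact (lintegral_eq_tsum_pieces hK (hf.indicator hA)).trans ((tsum_congr hpiece).trans
    (lintegral_eq_tsum_pieces hK (hg.indicator hA)).symm)

end Markov

/-- **Restricted strong-Markov (fresh-tail) identity of the Lambertian hard-sphere flow on `𝕋³`,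
`0 < ε < 1/2`** (stub `stub_markovLambda`, line `Sketch` of the crux `LambertianEuler`): for a
datum `z`, a time `s ≥ 0`, checkpoints `0 ≤ r_i ≤ s`, a measurable set `Q` of checkpoint values
and a measurable `H ≥ 0` on (state, noise sequence), restricted to the event that the collision
instants pass beyond `s` and the checkpoint states `(Λ_{r_i}(z; ξs))_i` lie in `Q`, the noise not
yet consumed at time `s`, `ξs (· + K_s)`, is a fresh `γ^ℕ` sequence independent of `Λ_s(z; ξs)` —
with NO almost-sure non-accumulation hypothesis (`lintegral_indicator_freshTail_of_local` for the
checkpoint event, which is local up to time `s` by `checkpointEvent_local`). [folklore] -/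
theorem stub_markovLambda :
    ∀ {ε : ℝ}, 0 < ε → ε < 2⁻¹ → ∀ {N : ℕ} (z : Config N (Fin 3) T3) (s : ℝ), 0 ≤ s →
      ∀ {m : ℕ} (r : Fin m → ℝ), (∀ i, 0 ≤ r i ∧ r i ≤ s) →
      ∀ {Q : Set (Fin m → Config N (Fin 3) T3)}, MeasurableSet Q →
      ∀ {H : Config N (Fin 3) T3 × (ℕ → V3) → ℝ≥0∞}, Measurable H →
        ∫⁻ ξs, {ξs : ℕ → V3 |
            (∃ k, ENNReal.ofReal s < lambertInstant (Torus.geometry (Fin 3)) ε ξs z k) ∧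
            (fun i => lambertFlow (Torus.geometry (Fin 3)) ε ξs z (r i)) ∈ Q}.indicator
            (fun ξs => H (lambertFlow (Torus.geometry (Fin 3)) ε ξs z s,
              fun n => ξs (n + lambertCount (Torus.geometry (Fin 3)) ε ξs z s))) ξs
            ∂(lambertNoise (Fin 3)) =
        ∫⁻ ξs, {ξs : ℕ → V3 |
            (∃ k, ENNReal.ofReal s < lambertInstant (Torus.geometry (Fin 3)) ε ξs z k) ∧
            (fun i => lambertFlow (Torus.geometry (Fin 3)) ε ξs z (r i)) ∈ Q}.indicator
            (fun ξs => ∫⁻ ηs, H (lambertFlow (Torus.geometry (Fin 3)) ε ξs z s, ηs)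
              ∂(lambertNoise (Fin 3))) ξs
            ∂(lambertNoise (Fin 3)) := by
  intro ε _hε hε' N z s _hs m r hr Q hQ H hH
  have hG : (Torus.geometry (Fin 3)).IsHardSphereRegular ε := Torus.isHardSphereRegular_geometry hε'
  have hGm : (Torus.geometry (Fin 3)).IsMeasurable := Torus.isMeasurable_geometry
  exact lintegral_indicator_freshTail_of_local hG hGm z s
    (measurableSet_checkpointEvent hG hGm z s r hQ) (fun ζ hζ => hζ.1)
    (fun ζ ζ' hζ h => checkpointEvent_local (fun i => (hr i).2) hζ.1 hζ.2 h) hH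

end Summit.AtomisticToContinuum.HydrodynamicLimit.Theorems.LambertianContactSwapLambertianEulerMarkov

end
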